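import Summits.BirchSwinnertonDyer.BirchSwinnertonDyer.Theorems.KimAtThreeDeepLowerOffStratumLevelLoweringVatsal
import Literature.NumberTheory.EllipticCurves.CanonicalPeriodSymbolCongruence
import Literature.NumberTheory.EllipticCurves.ModularCurveNonempty
import Literature.NumberTheory.EllipticCurves.RankinSeriesTwistEulerFactorProofs
import HarnessLib

/-!
# Route `KimAtThreeKolyvagin` (rung W2), crux `DeepLowerAtThreeOffKatoStratum` (item 19679), registered
# stub `stub_nonAdditive`, ROAD (b): the rows with `v₃(∏ c_ℓ) ≤ 1` from VATSAL 1999 / GREENBERG–VATSAL 2000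
# BY NAME (sequel to `KimAtThreeDeepLowerOffStratumLevelLoweringVatsal`)

Cell `bsd-addord`, seat `bsd-addord-w2-acc2` (PROGRAMME PART 1b, ACCEL-LIST row (2)), gen 4; item
`stmt-BirchSwinnertonDyer-19679` (OWNER w2-c2 assembles; this file is `--supports`, closes nothing). The core
file proved THEOREM A (core): the CONCLUSION SHAPE of Vatsal's canonical-period symbol congruence for a pair
`(f, g')` at level `N` + the OLD SHAPE of `g'`'s plus symbol + NON-DEGENERACY ⟹ the displayed hypothesis
(LL_1) `IsStabilisedLevelLoweringCongruenceIn W 3 1 f q π` over `𝓀 = 𝒪_{ℚ̄₃}/𝔪`. Here the conclusion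
shape is DISCHARGED by the two NAMED FACTS of
`Literature/NumberTheory/EllipticCurves/CanonicalPeriodSymbolCongruence.lean` (bsd-litref seat jsw17-ty,
p473060 / p474542):

* §3 `isStabilisedLevelLoweringCongruenceIn_of_vatsal` — at a GOOD `3` (`3 ∤ N`; ordinary OR supersingular):
  `vatsal1999_plusSymbol_congruence` (Vatsal 1999 (1.6)/(11)/Rem. (1.12), Condition 2 ⟸ Thm. (1.13) first
  bullet `p = 3 ∤ M = N`, `p > k = 2`) applied to `(D₀.f, g')`;
  `isStabilisedLevelLoweringCongruenceIn_of_greenbergVatsal` — at a good-ORDINARY or MULTIPLICATIVE `3`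
  (`9 ∤ N`): `greenbergVatsal2000_plusSymbol_congruence` (GV 2000 §3
  (17)–(19)) applied to `f₀ = f = D₀.f` in its own Hecke family (`U₃`-eigenvalue `a₃(E) = ±1` a unit when
  `3 ∥ N`, `valuation_cuspCoeff_three_eq_one_of_mult`). The `f`-side hypotheses of the facts are discharged
  (`IsNewformOf`: eigenform, normalised, coefficient field `ℚ`, integral coefficients, irreducible `W[3]`
  from tower-surjectivity); Condition 1 for `D₀.f` and EVERYTHING about `g'` stay DISPLAYED.
* §4 ★ `stub_nonAdditive_covered_of_vatsal` / ★ `stub_nonAdditive_semistable_of_vatsal` — the registered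
  stub's binders VERBATIM, then «ordinary if good, (ram) if multiplicative» (resp. `Semistable W₀`),
  `v₃(∏ c_ℓ) ≤ 1`, and the ROAD-(b) DATA at a prime `q ∣ N` in `CuspForm` / `plusSymbol` currency
  (`ι : ℚ̄₃ ≃ ℂ`; Condition 1 for `D₀.f`; a normalised Hecke eigenform `g' ∈ S₂(Γ₀(N))` with number-field,
  `3`-integral coefficients, Condition 1, `aₙ(D₀.f) ≡ aₙ(g') (mod 𝔪)` for ALL `n`; its old shape `(Φ, c, b)`;
  the non-degeneracy `Ω`) ⟹ the 19679 row, through gen 2's re-keyed consumers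
  `KimAtThreeDeepLowerOffStratumLevelLoweringRekey.stub_nonAdditive_{covered,semistable}_of_…CongruenceIn`
  (cell b2b-bsdres' certificate ⟹ Tamagawa divisibility of the deep Kurihara numbers at exponent `1`).
  `isStabilisedLevelLoweringCongruenceIn_three_of_not_addv` packages the case split good / multiplicative.

IN PRINT, the displayed road-(b) data are: `g'` = the `q`-stabilisation `g − β g(q·)` (`β ≡ q`, `U_q`-eigenvalue
`α = a_q(g) − β ≡ 1 = a_q(E)`) of Ribet's level-`N/q` newform `g` at the Tamagawa-`3` prime `q ∥ N`
(`3 ∣ c_q`, split multiplicative, `ρ̄_{E,3}` unramified at `q`; Ribet 1990 Thm. 1.1 = tree fact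
`diamond1995_refinedSerre`), `Φ = plusSymbol g` (`{∞, x}_{g(q·)} = q⁻¹{∞, qx}_g`; tree `iota`,
`modularSymbol_slash_tpD`), `c = β/q`, `b_ℓ = a_ℓ(g)`; Condition 1 for `g'` = semisimplicity of `U_q` on the
`q`-old plane (`α ≠ β`); `Ω` = Ihara's lemma (Ribet 1984 Thm. 4.1, tree fact `ribet1984_iharaLemma`) read on
symbols. None of these is asserted; all are hypotheses. NET for the stub's residual on the non-additive rows
with exactly one `3` in `∏ c_ℓ`: {Ribet's `g` in `CuspForm` currency with its congruences at ALL primes,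
`α ≠ β`, Ihara non-degeneracy} + named print — gen 2's Eichler–Shimura multiplicity-one node and its `p = 3`
rider «a prime `≡ 2 (mod 3)` divides `N`» are no longer needed on this road. Theorems only; nothing booked;
BSD is not proved by any of this.

## References

* V. Vatsal, Duke Math. J. 98 (1999), §1 (1.1)–(1.7), (11), Remark (1.12), Thm. (1.13). [Vatsal1999]
* R. Greenberg, V. Vatsal, Invent. Math. 142 (2000), §3 (17)–(19), Thm. (3.10). [GreenbergVatsal2000]
* K. A. Ribet, Invent. Math. 100 (1990), Thm. 1.1 [Ribet1990]; Proc. ICM 1983 (1984), Thm. 4.1 [Ribet1984ICM].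
* J. H. Silverman, *The Arithmetic of Elliptic Curves* (2009), §C.16. [SilvermanAEC2009]
* F. Diamond, J. Shurman, *A First Course in Modular Forms* (2005), Thm. 3.5.1. [DiamondShurman2005]
* C.-H. Kim (2022/2026), §1.5.1, Conj. 1.10 [Kim2022StructureSelmer]; C. Skinner, Pacific J. Math. 283 (2016),
  Thm. C [Skinner2016PacificMC]; X. Yan, X. Zhu (2024/2026), Thm. 4.15 [YanZhu2024MainConjNonCM];
  B. Mazur, Invent. Math. 44 (1978), Cor. 4.1 [Mazur1978].
-/

set_option autoImplicit false
-- the Theorems namespace of a single-conjunct summit repeats the summit name by design (D-0017)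
set_option linter.dupNamespace false

noncomputable section

open scoped MatrixGroups ModularForm Classical NNReal

open CongruenceSubgroup WeierstrassCurve Literature.NumberTheory.EllipticCurves
  Literature.NumberTheory.EllipticCurves.ModularForms

namespace Summit.BirchSwinnertonDyer.BirchSwinnertonDyer.Theorems.KimAtThreeDeepLowerOffStratumLevelLoweringVatsalRows

open Summit.BirchSwinnertonDyer.BirchSwinnertonDyer.Theorems.KimAtThreeDeepLowerOffStratumLevelLoweringVatsal

/-! ### §3 THEOREM A: the conclusion shape from the NAMED FACTS (Vatsal 1999 at `3 ∤ N`; Greenberg–Vatsal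
2000 at a good-ordinary or multiplicative `3`) -/

section Facts

variable (W : WeierstrassCurve ℚ) [W.IsElliptic] [W.IsGloballyMinimal] {N : ℕ} [NeZero N]
  {f g' : CuspForm (Gamma0 N) 2}

omit [W.IsElliptic] [W.IsGloballyMinimal] in
/-- The newform of an elliptic curve has a finite-dimensional (indeed trivial) coefficient field. [folklore] -/
theorem finiteDimensional_coeffField_of_isNewformOf (hf : IsNewformOf W f) :
    FiniteDimensional ℚ (coeffField f) := by
  rw [hf.coeffField_eq_bot]
  infer_instance

omit [W.IsElliptic] [W.IsGloballyMinimal] in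
/-- The coefficients `aₙ(f) = aₙ(E) ∈ ℤ` of the newform of `E` are `3`-adically integral. [folklore] -/
theorem valuation_cuspCoeff_le_one_of_isNewformOf (hf : IsNewformOf W f) (ι : PadicAlgCl 3 ≃+* ℂ) (n : ℕ) :
    Valued.v (ι.symm (cuspCoeff f n)) ≤ 1 := by
  rw [hf.2 n, map_intCast]
  exact valuation_le_one_iff.mpr (norm_intCast_le_one _)

/-- **THEOREM A at a prime `3` of GOOD reduction (`3 ∤ N`) — Vatsal 1999 BY NAME.** For the newform
`f` of `W` at level `N = N_E` (tower row: `W[3]` irreducible), `3 ∤ N`, `3`-integral `[x]⁺_f`, Condition 1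
for `f`; a normalised Hecke eigenform `g' ∈ S₂(Γ₀(N))` with number-field, `3`-integral coefficients,
Condition 1, and `aₙ(f) ≡ aₙ(g') (mod 𝔪)` for ALL `n`; whose plus symbol has the old shape
`Φ(x) − cΦ(qx)` (`c ≡ 1`, `Φ` periodic and Hecke at `ℓ ∤ 3N_E` with eigenvalues `≡ a_ℓ(E)`) and is
non-degenerate (`Φ/Ω` integral with `(Φ(x₀) − cΦ(qx₀))/Ω` a unit): the named fact
`vatsal1999_plusSymbol_congruence` (Vatsal 1999 (1.6), Thm. (1.13) first bullet: `p = 3 ∤ M = N`,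
`p > k = 2`) supplies the symbol congruence, and the core file gives (LL_1) over `𝓀`.
[cite: Vatsal1999, §1 (1.6) display (11), Remark (1.12), Thm. (1.13)] [cite: GreenbergVatsal2000, §3 (18)–(19)] -/
theorem isStabilisedLevelLoweringCongruenceIn_of_vatsal (hV : vatsal1999_plusSymbol_congruence)
    (hf : IsNewformOf W f) (ι : PadicAlgCl 3 ≃+* ℂ) (h3N : ¬ 3 ∣ N) (h4 : 4 ≤ N)
    (hirr : W.HasIrreducibleModPGaloisRep 3)
    (hint : ∀ r : ℚ, ratPlusSymbol f r ≠ 0 → 0 ≤ padicValRat 3 (ratPlusSymbol f r))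
    (hfC : HasSimpleHeckeGenEigenspace f)
    (hg : IsHeckeEigenform g') (hg1 : IsNormalized g') (hgK : FiniteDimensional ℚ (coeffField g'))
    (hgint : ∀ n : ℕ, Valued.v (ι.symm (cuspCoeff g' n)) ≤ 1) (hgC : HasSimpleHeckeGenEigenspace g')
    (hcong : ∀ n : ℕ, Valued.v (ι.symm (cuspCoeff f n - cuspCoeff g' n)) < 1)
    (q : ℕ) (Φ : ℚ → ℂ) (c : ℂ) (b : ℕ → ℂ)
    (hshape : ∀ x : ℚ, plusSymbol g' x = Φ x - c * Φ (q * x))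
    (hc : Valued.v (ι.symm (c - 1)) < 1)
    (hΦper : ∀ x : ℚ, Φ (x + 1) = Φ x)
    (hb : ∀ ℓ : ℕ, ℓ.Prime → ¬ ℓ ∣ W.conductorNorm ℤ * 3 →
      Valued.v (ι.symm (b ℓ - (W.frobeniusTrace ℓ : ℂ))) < 1)
    (hΦhecke : ∀ ℓ : ℕ, ℓ.Prime → ¬ ℓ ∣ W.conductorNorm ℤ * 3 → ∀ x : ℚ,
      b ℓ * Φ x = (∑ j : Fin ℓ, Φ ((x + j) / ℓ)) + Φ (ℓ * x))
    {Ω : ℂ} (hΩint : ∀ x : ℚ, Valued.v (ι.symm (Φ x / Ω)) ≤ 1)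
    (hΩunit : ∃ x₀ : ℚ, Valued.v (ι.symm ((Φ x₀ - c * Φ (q * x₀)) / Ω)) = 1) :
    ∃ π : ZMod 3 →+* IsLocalRing.ResidueField (Valued.integer (PadicAlgCl 3)),
      IsStabilisedLevelLoweringCongruenceIn W 3 1 f q π := by
  have hW : ∀ ℓ : ℕ, ℓ.Prime → ¬ ℓ ∣ N * 3 → Valued.v (ι.symm (cuspCoeff f ℓ - (W.LFunction ℓ : ℂ))) < 1 := by
    intro ℓ _ _
    rw [hf.2 ℓ, sub_self, map_zero, Valuation.map_zero]
    exact zero_lt_one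
  obtain ⟨Ωf, Ωg, hΩf, hΩg, -, hψint, hcongr, x₁, hx₁⟩ :=
    hV 3 N ι W f g' (by norm_num) h3N h4 hf.1.2.1 hf.1.2.2 (finiteDimensional_coeffField_of_isNewformOf W hf)
      (valuation_cuspCoeff_le_one_of_isNewformOf W hf ι) hfC hg hg1 hgK hgint hgC hcong hirr hW
  exact isStabilisedLevelLoweringCongruenceIn_of_symbolCongruence W hf ι hint hΩf hΩg hψint hcongr ⟨x₁, hx₁⟩
    q Φ c b hshape hc hΦper hb hΦhecke hΩint hΩunit

/-- **THEOREM A at a GOOD-ORDINARY or MULTIPLICATIVE `3` (`9 ∤ N`) — Greenberg–Vatsal 2000 BY NAME.** Same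
data; the named fact `greenbergVatsal2000_plusSymbol_congruence` (GV 2000 §3 (17)–(19) with Vatsal Thm.
(1.13) second bullet) is applied to `f₀ = f` (the newform of `W`, in its own Hecke family at `M = N`,
`U₃`-eigenvalue `a₃(E) = ±1` a unit when `3 ∥ N`) and `g'`.
[cite: GreenbergVatsal2000, §3 (17)–(19), proof of Thm. (3.10)] [cite: Vatsal1999, §1 (1.6), Thm. (1.13)] -/
theorem isStabilisedLevelLoweringCongruenceIn_of_greenbergVatsal (hGV : greenbergVatsal2000_plusSymbol_congruence)
    (hf : IsNewformOf W f) (ι : PadicAlgCl 3 ≃+* ℂ) (h9N : ¬ 3 ^ 2 ∣ N) (h5 : 5 ≤ N)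
    (hred : IsOrdinaryAt W 3 ∨ W.HasMultiplicativeReductionAtPrime 3)
    (hirr : W.HasIrreducibleModPGaloisRep 3)
    (ha3 : 3 ∣ N → Valued.v (ι.symm (cuspCoeff f 3)) = 1)
    (hint : ∀ r : ℚ, ratPlusSymbol f r ≠ 0 → 0 ≤ padicValRat 3 (ratPlusSymbol f r))
    (hfC : HasSimpleHeckeGenEigenspace f)
    (hg : IsHeckeEigenform g') (hg1 : IsNormalized g') (hgK : FiniteDimensional ℚ (coeffField g'))
    (hgint : ∀ n : ℕ, Valued.v (ι.symm (cuspCoeff g' n)) ≤ 1) (hgC : HasSimpleHeckeGenEigenspace g')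
    (hcong : ∀ n : ℕ, Valued.v (ι.symm (cuspCoeff f n - cuspCoeff g' n)) < 1)
    (q : ℕ) (Φ : ℚ → ℂ) (c : ℂ) (b : ℕ → ℂ)
    (hshape : ∀ x : ℚ, plusSymbol g' x = Φ x - c * Φ (q * x))
    (hc : Valued.v (ι.symm (c - 1)) < 1)
    (hΦper : ∀ x : ℚ, Φ (x + 1) = Φ x)
    (hb : ∀ ℓ : ℕ, ℓ.Prime → ¬ ℓ ∣ W.conductorNorm ℤ * 3 →
      Valued.v (ι.symm (b ℓ - (W.frobeniusTrace ℓ : ℂ))) < 1)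
    (hΦhecke : ∀ ℓ : ℕ, ℓ.Prime → ¬ ℓ ∣ W.conductorNorm ℤ * 3 → ∀ x : ℚ,
      b ℓ * Φ x = (∑ j : Fin ℓ, Φ ((x + j) / ℓ)) + Φ (ℓ * x))
    {Ω : ℂ} (hΩint : ∀ x : ℚ, Valued.v (ι.symm (Φ x / Ω)) ≤ 1)
    (hΩunit : ∃ x₀ : ℚ, Valued.v (ι.symm ((Φ x₀ - c * Φ (q * x₀)) / Ω)) = 1) :
    ∃ π : ZMod 3 →+* IsLocalRing.ResidueField (Valued.integer (PadicAlgCl 3)),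
      IsStabilisedLevelLoweringCongruenceIn W 3 1 f q π := by
  obtain ⟨Ωf, Ωg, hΩf, hΩg, -, hψint, hcongr, x₁, hx₁⟩ :=
    hGV 3 N N ι W f f g' (by norm_num) h5 dvd_rfl h9N hred hirr hf hf.1.2.1 hf.1.2.2
      (finiteDimensional_coeffField_of_isNewformOf W hf) (valuation_cuspCoeff_le_one_of_isNewformOf W hf ι) hfC
      (fun n _ => hf.2 n) ha3 hg hg1 hgK hgint hgC hcong
  exact isStabilisedLevelLoweringCongruenceIn_of_symbolCongruence W hf ι hint hΩf hΩg hψint hcongr ⟨x₁, hx₁⟩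
    q Φ c b hshape hc hΦper hb hΦhecke hΩint hΩunit

end Facts

/-! ### §4 ★ Crux 19679, registered stub `stub_nonAdditive`: the rows with `v₃(∏ c_ℓ) ≤ 1` from ROAD (b) -/

section Rows

open Summit.BirchSwinnertonDyer.BirchSwinnertonDyer.Theorems.KimAtThreeDeepLowerOffStratumLevelLoweringRekey
open Summit.BirchSwinnertonDyer.BirchSwinnertonDyer.Theorems.KimAtThreeShallowEqDeepOffStratumNonAdditiveRows
  (not_sq_dvd_conductorNorm_of_not_addv)
open Literature.NumberTheory.EllipticCurves.Rank1Residual Literature.NumberTheory.EllipticCurves.Rank1Residual.Typed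
  Literature.NumberTheory.EllipticCurves.Skinner2016 Literature.NumberTheory.Automorphic

/-- A level carrying a modular parametrisation datum is `≥ 11` (the levels `1, …, 10` have genus zero:
`ModularParametrizationData_isEmpty_of_mem_genusZeroLevels`). [cite: DiamondShurman2005, Thm. 3.5.1 with Figure 3.3] -/
theorem eleven_le_of_modularParametrizationData (W : WeierstrassCurve ℚ) {N : ℕ} [NeZero N]
    (D : ModularParametrizationData W N) : 11 ≤ N := by
  by_contra hlt
  push Not at hlt
  have hpos : 0 < N := Nat.pos_of_ne_zero (NeZero.ne N)
  have key : ∀ n : ℕ, 0 < n → n < 11 →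
      n ∈ ({1, 2, 3, 4, 5, 6, 7, 8, 9, 10, 12, 13, 16, 18, 25} : Finset ℕ) := by
    intro n h0 h1
    interval_cases n <;> decide
  exact (ModularParametrizationData_isEmpty_of_mem_genusZeroLevels W N (key N hpos hlt)).false D

/-- At a prime `3` of multiplicative reduction `a₃(E) = ±1` is a `3`-adic unit (Silverman *AEC* §C.16; tree
`LFunction_prime_pow_of_hasMultiplicativeReductionAtPrime`). [cite: SilvermanAEC2009, §C.16 (definition of L_v(T))] -/
theorem valuation_cuspCoeff_three_eq_one_of_mult (W : WeierstrassCurve ℚ) [W.IsElliptic] {N : ℕ} [NeZero N]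
    {f : CuspForm (Gamma0 N) 2} (hf : IsNewformOf W f) (ι : PadicAlgCl 3 ≃+* ℂ)
    (hmult : W.HasMultiplicativeReductionAtPrime 3) : Valued.v (ι.symm (cuspCoeff f 3)) = 1 := by
  have hsq : W.LFunction 3 ^ 2 = 1 := (LFunction_prime_pow_of_hasMultiplicativeReductionAtPrime W 3 hmult 0).2
  rw [hf.2 3, map_intCast]
  refine valuation_eq_one_iff.mpr ?_
  have h : ‖((W.LFunction 3 : ℤ) : PadicAlgCl 3)‖ ^ 2 = 1 := by
    rw [← norm_pow, ← Int.cast_pow, hsq, Int.cast_one, norm_one]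
  exact (pow_eq_one_iff_of_nonneg (norm_nonneg _) two_ne_zero).mp h

/-- **(LL_1) over `𝓀` on a NON-ADDITIVE optimal tower row, from ROAD (b)** — both named facts
(`vatsal1999_plusSymbol_congruence` at good `3`, `greenbergVatsal2000_plusSymbol_congruence` at
multiplicative `3`), the row binders of the registered stub (tower-surjective `W₀`, `N = N_E`, datum `D₀`,
`3`-integral `[x]⁺`), `¬ Addv W₀ 3`, and the displayed road-(b) data at the prime `q`: Condition 1 for
`D₀.f`, the congruent level-`N` eigenform `g'` (Vatsal's hypotheses), the old shape `(Φ, c, b)` of its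
plus symbol, the non-degeneracy `Ω`. No ordinarity is needed at a good `3` (Vatsal Thm. (1.13) first
bullet). [cite: Vatsal1999, §1 (1.6), Thm. (1.13)] [cite: GreenbergVatsal2000, §3 (17)–(19)]
[cite: SilvermanAEC2009, §C.16 (definition of L_v(T))] -/
theorem isStabilisedLevelLoweringCongruenceIn_three_of_not_addv (hV : vatsal1999_plusSymbol_congruence)
    (hGV : greenbergVatsal2000_plusSymbol_congruence)
    (W₀ : WeierstrassCurve ℚ) [W₀.IsElliptic] [W₀.IsGloballyMinimal]
    (htower : ∀ n : ℕ, W₀.HasSurjectiveModNGaloisRep (3 ^ n : ℕ)) {N : ℕ} [NeZero N]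
    (hN : N = W₀.conductorNorm ℤ) (D₀ : ModularParametrizationData W₀ N)
    (hint : ∀ r : ℚ, ratPlusSymbol D₀.f r ≠ 0 → 0 ≤ padicValRat 3 (ratPlusSymbol D₀.f r))
    (hnA : ¬ (haveI : Fact (Nat.Prime 3) := ⟨Nat.prime_three⟩; Addv W₀ 3))
    (ι : PadicAlgCl 3 ≃+* ℂ) (g' : CuspForm (Gamma0 N) 2) (q : ℕ)
    (hfC : HasSimpleHeckeGenEigenspace D₀.f)
    (hg : IsHeckeEigenform g') (hg1 : IsNormalized g') (hgK : FiniteDimensional ℚ (coeffField g'))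
    (hgint : ∀ n : ℕ, Valued.v (ι.symm (cuspCoeff g' n)) ≤ 1) (hgC : HasSimpleHeckeGenEigenspace g')
    (hcong : ∀ n : ℕ, Valued.v (ι.symm (cuspCoeff D₀.f n - cuspCoeff g' n)) < 1)
    (Φ : ℚ → ℂ) (c : ℂ) (b : ℕ → ℂ)
    (hshape : ∀ x : ℚ, plusSymbol g' x = Φ x - c * Φ (q * x))
    (hc : Valued.v (ι.symm (c - 1)) < 1)
    (hΦper : ∀ x : ℚ, Φ (x + 1) = Φ x)
    (hb : ∀ ℓ : ℕ, ℓ.Prime → ¬ ℓ ∣ W₀.conductorNorm ℤ * 3 →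
      Valued.v (ι.symm (b ℓ - (W₀.frobeniusTrace ℓ : ℂ))) < 1)
    (hΦhecke : ∀ ℓ : ℕ, ℓ.Prime → ¬ ℓ ∣ W₀.conductorNorm ℤ * 3 → ∀ x : ℚ,
      b ℓ * Φ x = (∑ j : Fin ℓ, Φ ((x + j) / ℓ)) + Φ (ℓ * x))
    {Ω : ℂ} (hΩint : ∀ x : ℚ, Valued.v (ι.symm (Φ x / Ω)) ≤ 1)
    (hΩunit : ∃ x₀ : ℚ, Valued.v (ι.symm ((Φ x₀ - c * Φ (q * x₀)) / Ω)) = 1) :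
    ∃ π : ZMod 3 →+* IsLocalRing.ResidueField (Valued.integer (PadicAlgCl 3)),
      IsStabilisedLevelLoweringCongruenceIn W₀ 3 1 D₀.f q π := by
  have hirr : W₀.HasIrreducibleModPGaloisRep 3 :=
    hasIrreducibleModPGaloisRep_of_hasSurjectiveModNGaloisRep W₀ 3 (by simpa using htower 1)
  have h11 : 11 ≤ N := eleven_le_of_modularParametrizationData W₀ D₀
  by_cases hgood : W₀.HasGoodReductionAtPrime 3
  · have h3N : ¬ 3 ∣ N := hN ▸ not_dvd_conductorNorm_of_hasGoodReductionAtPrime W₀ hgood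
    exact isStabilisedLevelLoweringCongruenceIn_of_vatsal W₀ hV D₀.isNewformOf ι h3N (by omega) hirr hint hfC
      hg hg1 hgK hgint hgC hcong q Φ c b hshape hc hΦper hb hΦhecke hΩint hΩunit
  · have hmult : W₀.HasMultiplicativeReductionAtPrime 3 := by
      by_contra hm
      exact hnA ⟨hgood, hm⟩
    have h9N : ¬ 3 ^ 2 ∣ N := hN ▸ not_sq_dvd_conductorNorm_of_not_addv W₀ hnA
    exact isStabilisedLevelLoweringCongruenceIn_of_greenbergVatsal W₀ hGV D₀.isNewformOf ι h9N (by omega)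
      (Or.inr hmult) hirr (fun _ => valuation_cuspCoeff_three_eq_one_of_mult W₀ D₀.isNewformOf ι hmult) hint hfC
      hg hg1 hgK hgint hgC hcong q Φ c b hshape hc hΦper hb hΦhecke hΩint hΩunit

/-- ★ **`stub_nonAdditive` on its COVERED rows with `v₃(∏ c_ℓ) ≤ 1` from ROAD (b) — Vatsal 1999 /
Greenberg–Vatsal 2000 BY NAME.** The registered stub's binders VERBATIM, then «ordinary if good, (ram) if
multiplicative», `v₃(∏ c_ℓ) ≤ 1`, and the road-(b) data at a prime `q ∣ N` DISPLAYED in the tree's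
`CuspForm` / `plusSymbol` currency: Condition 1 for `D₀.f`; a normalised Hecke eigenform `g' ∈ S₂(Γ₀(N))`
(number-field, `3`-integral coefficients, Condition 1) with `aₙ(D₀.f) ≡ aₙ(g') (mod 𝔪)` for all `n` — in
print the `q`-stabilisation `g − β g(q·)` of Ribet's level-`N/q` newform (Ribet 1990 Thm. 1.1 /
`diamond1995_refinedSerre`); the OLD SHAPE `plusSymbol g' = Φ − c·Φ(q·)`, `c ≡ 1`, `Φ` periodic and Hecke at
`ℓ ∤ 3N` with eigenvalues `≡ a_ℓ(E)`; and the NON-DEGENERACY `Ω` (Ihara's lemma, Ribet 1984 Thm. 4.1, read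
on symbols). EIGHT named facts (`hV hGV hYZ hW20 hSk hmod hGZK hM`). Relative to gen 2's
`…LevelLoweringFromPrint.stub_nonAdditive_covered_of_wiles1995_ihara` the Eichler–Shimura multiplicity-one
node and its `p = 3` rider are GONE. [cite: Vatsal1999, §1 (1.6), Thm. (1.13)] [cite: GreenbergVatsal2000, §3 (17)–(19)]
[cite: Ribet1990, Thm. 1.1] [cite: Ribet1984ICM, Thm. 4.1] [cite: YanZhu2024MainConjNonCM, Thm. 4.15 (§4.6)]
[cite: Skinner2016PacificMC, Thm. C (§1)] [cite: Mazur1978, Cor. 4.1]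
[cite: Kim2022StructureSelmer, Conj. 1.10 (PDF p. 8)] -/
theorem stub_nonAdditive_covered_of_vatsal
    (hV : vatsal1999_plusSymbol_congruence) (hGV : greenbergVatsal2000_plusSymbol_congruence)
    (hYZ : YanZhu2026.thm415_padicValRat_bsd_rank_le_one)
    (hW20 : Wuthrich2014.lemma20_surjective_threeAdic_of_semistable)
    (hSk : Skinner2016.thmC_padicValRat_bsd_rank_zero)
    (hmod : hasEntireLFunction_rat) (hGZK : rank_eq_analyticRank_of_analyticRank_le_one)
    (hM : mazur_not_dvd_maninConstant_of_odd) :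
    ∀ (W₀ : WeierstrassCurve ℚ) [W₀.IsElliptic] [W₀.IsGloballyMinimal],
      (∀ n : ℕ, W₀.HasSurjectiveModNGaloisRep (3 ^ n : ℕ)) → Finite W₀.sha →
      ∀ {N : ℕ} [NeZero N], N = W₀.conductorNorm ℤ →
      ∀ (D₀ : ModularParametrizationData W₀ N),
        (∀ z ∈ D₀.L.lattice, ∃ w ∈ periodLattice D₀.f, z = D₀.c * w) →
        (∀ (W₂ : WeierstrassCurve ℚ) [W₂.IsElliptic] (D₂ : ModularParametrizationData W₂ N),
          D₂.f = D₀.f → D₀.modularDegree ≤ D₂.modularDegree) →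
        (∀ r : ℚ, ratPlusSymbol D₀.f r ≠ 0 → 0 ≤ padicValRat 3 (ratPlusSymbol D₀.f r)) →
        kuriharaVanishingOrder W₀ 3 D₀.f = 0 →
        ¬ (haveI : Fact (Nat.Prime 3) := ⟨Nat.prime_three⟩; Addv W₀ 3) →
        (W₀.HasGoodReductionAtPrime 3 → ¬ (3 : ℤ) ∣ W₀.frobeniusTrace 3) →
        (W₀.HasMultiplicativeReductionAtPrime 3 →
          (haveI : Fact (Nat.Prime 3) := ⟨Nat.prime_three⟩; Ram W₀ 3)) →
        padicValNat 3 W₀.tamagawaProduct ≤ 1 →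
        ∀ (ι : PadicAlgCl 3 ≃+* ℂ) (g' : CuspForm (Gamma0 N) 2) (q : ℕ), q ∣ W₀.conductorNorm ℤ →
          HasSimpleHeckeGenEigenspace D₀.f →
          IsHeckeEigenform g' → IsNormalized g' → FiniteDimensional ℚ (coeffField g') →
          (∀ n : ℕ, Valued.v (ι.symm (cuspCoeff g' n)) ≤ 1) → HasSimpleHeckeGenEigenspace g' →
          (∀ n : ℕ, Valued.v (ι.symm (cuspCoeff D₀.f n - cuspCoeff g' n)) < 1) →
        ∀ (Φ : ℚ → ℂ) (c : ℂ) (b : ℕ → ℂ),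
          (∀ x : ℚ, plusSymbol g' x = Φ x - c * Φ (q * x)) →
          Valued.v (ι.symm (c - 1)) < 1 →
          (∀ x : ℚ, Φ (x + 1) = Φ x) →
          (∀ ℓ : ℕ, ℓ.Prime → ¬ ℓ ∣ W₀.conductorNorm ℤ * 3 →
            Valued.v (ι.symm (b ℓ - (W₀.frobeniusTrace ℓ : ℂ))) < 1) →
          (∀ ℓ : ℕ, ℓ.Prime → ¬ ℓ ∣ W₀.conductorNorm ℤ * 3 → ∀ x : ℚ,
            b ℓ * Φ x = (∑ j : Fin ℓ, Φ ((x + j) / ℓ)) + Φ (ℓ * x)) →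
        ∀ (Ω : ℂ), (∀ x : ℚ, Valued.v (ι.symm (Φ x / Ω)) ≤ 1) →
          (∃ x₀ : ℚ, Valued.v (ι.symm ((Φ x₀ - c * Φ (q * x₀)) / Ω)) = 1) →
        ∃ d : ℕ, kuriharaPartialDeepInfty W₀ 3 D₀.f = d ∧
          kuriharaPartial W₀ 3 D₀.f 0 ≤
            ((padicValNat 3 (Nat.card (AddCommGroup.primaryComponent W₀.sha 3)) + d : ℕ) : ℕ∞) := by
  intro W₀ _ _ htower hfin N _ hN D₀ hopt hdeg hint hord hnA hordinary hram hv ι g' q hq hfC hg hg1 hgK hgint hgC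
    hcong Φ c b hshape hc hΦper hb hΦhecke Ω hΩint hΩunit
  obtain ⟨π, hLL⟩ := isStabilisedLevelLoweringCongruenceIn_three_of_not_addv hV hGV W₀ htower hN D₀ hint hnA ι g'
    q hfC hg hg1 hgK hgint hgC hcong Φ c b hshape hc hΦper hb hΦhecke hΩint hΩunit
  exact stub_nonAdditive_covered_of_isStabilisedLevelLoweringCongruenceIn hYZ hW20 hSk hmod hGZK hM W₀ htower hfin
    hN D₀ hopt hdeg hint hord hnA hordinary hram hv π q hq hLL

/-- ★ **The same on the SEMISTABLE rows** (no (ram), no Yan–Zhu binder: on a semistable row (ram) at `3` is the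
theorem `ram_three_of_semistable_of_irr`): named facts `hV hGV hSk hmod hGZK hM hBCDT hLL'` + the road-(b)
data. [cite: Vatsal1999, §1 (1.6), Thm. (1.13)] [cite: GreenbergVatsal2000, §3 (17)–(19)]
[cite: Skinner2016PacificMC, Thm. C (§1)] [cite: Ribet1990, Thm. 1.1] [cite: Mazur1978, Cor. 4.1]
[cite: Kim2022StructureSelmer, Conj. 1.10 (PDF p. 8)] -/
theorem stub_nonAdditive_semistable_of_vatsal
    (hV : vatsal1999_plusSymbol_congruence) (hGV : greenbergVatsal2000_plusSymbol_congruence)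
    (hSk : Skinner2016.thmC_padicValRat_bsd_rank_zero)
    (hmod : hasEntireLFunction_rat) (hGZK : rank_eq_analyticRank_of_analyticRank_le_one)
    (hM : mazur_not_dvd_maninConstant_of_odd)
    (hBCDT : exists_isNewformOf) (hLL' : diamond1995_refinedSerre) :
    ∀ (W₀ : WeierstrassCurve ℚ) [W₀.IsElliptic] [W₀.IsGloballyMinimal],
      (∀ n : ℕ, W₀.HasSurjectiveModNGaloisRep (3 ^ n : ℕ)) → Finite W₀.sha →
      ∀ {N : ℕ} [NeZero N], N = W₀.conductorNorm ℤ →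
      ∀ (D₀ : ModularParametrizationData W₀ N),
        (∀ z ∈ D₀.L.lattice, ∃ w ∈ periodLattice D₀.f, z = D₀.c * w) →
        (∀ (W₂ : WeierstrassCurve ℚ) [W₂.IsElliptic] (D₂ : ModularParametrizationData W₂ N),
          D₂.f = D₀.f → D₀.modularDegree ≤ D₂.modularDegree) →
        (∀ r : ℚ, ratPlusSymbol D₀.f r ≠ 0 → 0 ≤ padicValRat 3 (ratPlusSymbol D₀.f r)) →
        kuriharaVanishingOrder W₀ 3 D₀.f = 0 →
        ¬ (haveI : Fact (Nat.Prime 3) := ⟨Nat.prime_three⟩; Addv W₀ 3) →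
        Semistable W₀ →
        (W₀.HasGoodReductionAtPrime 3 → ¬ (3 : ℤ) ∣ W₀.frobeniusTrace 3) →
        padicValNat 3 W₀.tamagawaProduct ≤ 1 →
        ∀ (ι : PadicAlgCl 3 ≃+* ℂ) (g' : CuspForm (Gamma0 N) 2) (q : ℕ), q ∣ W₀.conductorNorm ℤ →
          HasSimpleHeckeGenEigenspace D₀.f →
          IsHeckeEigenform g' → IsNormalized g' → FiniteDimensional ℚ (coeffField g') →
          (∀ n : ℕ, Valued.v (ι.symm (cuspCoeff g' n)) ≤ 1) → HasSimpleHeckeGenEigenspace g' →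
          (∀ n : ℕ, Valued.v (ι.symm (cuspCoeff D₀.f n - cuspCoeff g' n)) < 1) →
        ∀ (Φ : ℚ → ℂ) (c : ℂ) (b : ℕ → ℂ),
          (∀ x : ℚ, plusSymbol g' x = Φ x - c * Φ (q * x)) →
          Valued.v (ι.symm (c - 1)) < 1 →
          (∀ x : ℚ, Φ (x + 1) = Φ x) →
          (∀ ℓ : ℕ, ℓ.Prime → ¬ ℓ ∣ W₀.conductorNorm ℤ * 3 →
            Valued.v (ι.symm (b ℓ - (W₀.frobeniusTrace ℓ : ℂ))) < 1) →
          (∀ ℓ : ℕ, ℓ.Prime → ¬ ℓ ∣ W₀.conductorNorm ℤ * 3 → ∀ x : ℚ,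
            b ℓ * Φ x = (∑ j : Fin ℓ, Φ ((x + j) / ℓ)) + Φ (ℓ * x)) →
        ∀ (Ω : ℂ), (∀ x : ℚ, Valued.v (ι.symm (Φ x / Ω)) ≤ 1) →
          (∃ x₀ : ℚ, Valued.v (ι.symm ((Φ x₀ - c * Φ (q * x₀)) / Ω)) = 1) →
        ∃ d : ℕ, kuriharaPartialDeepInfty W₀ 3 D₀.f = d ∧
          kuriharaPartial W₀ 3 D₀.f 0 ≤
            ((padicValNat 3 (Nat.card (AddCommGroup.primaryComponent W₀.sha 3)) + d : ℕ) : ℕ∞) := by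
  intro W₀ _ _ htower hfin N _ hN D₀ hopt hdeg hint hord hnA hsst hordinary hv ι g' q hq hfC hg hg1 hgK hgint hgC
    hcong Φ c b hshape hc hΦper hb hΦhecke Ω hΩint hΩunit
  obtain ⟨π, hLL⟩ := isStabilisedLevelLoweringCongruenceIn_three_of_not_addv hV hGV W₀ htower hN D₀ hint hnA ι g'
    q hfC hg hg1 hgK hgint hgC hcong Φ c b hshape hc hΦper hb hΦhecke hΩint hΩunit
  exact stub_nonAdditive_semistable_of_isStabilisedLevelLoweringCongruenceIn hSk hmod hGZK hM hBCDT hLL' W₀ htower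
    hfin hN D₀ hopt hdeg hint hord hnA hsst hordinary hv π q hq hLL

end Rows

end Summit.BirchSwinnertonDyer.BirchSwinnertonDyer.Theorems.KimAtThreeDeepLowerOffStratumLevelLoweringVatsalRows

end
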